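import Literature.Analysis.FluidPDE.AdaptedBackwardKernel
import Literature.Analysis.FluidPDE.WholeSpaceIBP
import HarnessLib

/-!
# `AdaptedKernelExists` (stmt-NavierStokesRegularity-2956): tools for the `div b = 0` load-bearing witness

Negative / support lemmas for the crux `AdaptedFrequency.AdaptedKernelExists`, extracted from the
crux work file `Cruxes/AdaptedKernelExists/Disproof.lean` (cdisprove seat, cycle 3, §7.B–§7.D). No
conclusion asserts a route item.

* §B the scaled cut-off `ψR R x = ψ₁ (R⁻¹ • x)` (`ψ₁` a fixed bump, `= 1` on `closedBall 0 1`,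
  supported in `closedBall 0 2`): `= 1` on `closedBall 0 R`, `= 0` off `ball 0 (2R)`, `Dψ_R = 0` and
  `Δψ_R = 0` on `ball 0 R`, dilation laws `fderiv_ψR` / `laplacian_ψR`, and the bounds
  `‖Dψ_R‖ ≤ M₁` (`M₁/R`), `|Δψ_R| ≤ M₂` (`M₂/R²`); a second fixed bump `φb` (bulk weight);
* §C the COMPRESSIBLE witness drift `bComp t x = arctan(x₀) • e₀`: jointly smooth, `‖b‖ ≤ 2`,
  `div b = 1/(1 + x₀²) ∈ (0, 1]`, `≥ 1/2` on the unit ball;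
* §D block-uniform Gaussian bookkeeping on `ℝ³`: integrability, the bulk lower bound on the unit ball
  and the tail bound off `ball 0 R` for times `h ∈ [h₂, h₁]`, the vanishing tail factor.

Used by `DivFreeLoadBearing.lean`; the cut-off and Gaussian lemmas are reusable by the picked line's
`stub_expMoment` / `stub_upperOfMoments`.
-/

noncomputable section

open MeasureTheory Set Function Filter Topology Metric
open scoped InnerProductSpace RealInnerProductSpace Laplacian ContDiff

namespace Summit.NavierStokesRegularity.NavierStokesRegularity.Theorems.AdaptedKernelExistsNegative.DivFree

open Literature.Analysis Literature.Analysis.FluidPDE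

/-- Local notation for physical space `ℝ³ = EuclideanSpace ℝ (Fin 3)`. -/
local notation "ℝ³" => EuclideanSpace ℝ (Fin 3)

/-! ### §B The scaled cut-off `ψ_R(x) = ψ₁(x/R)` with `R`-uniform derivative bounds -/

section Bump

/-- A fixed smooth bump: `= 1` on `closedBall 0 1`, supported in `closedBall 0 2`. -/
def ψ₁ : ContDiffBump (0 : ℝ³) := ⟨1, 2, one_pos, one_lt_two⟩

/-- `ψ₁.rIn = 1`. -/
@[simp] theorem ψ₁_rIn : ψ₁.rIn = 1 := rfl
/-- `ψ₁.rOut = 2`. -/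
@[simp] theorem ψ₁_rOut : ψ₁.rOut = 2 := rfl

/-- A second fixed bump (the bulk weight): `= 1` on `closedBall 0 (1/2)`, supported in
`closedBall 0 1`. -/
def φb : ContDiffBump (0 : ℝ³) := ⟨1 / 2, 1, by norm_num, by norm_num⟩

/-- `φb.rOut = 1`. -/
@[simp] theorem φb_rOut : φb.rOut = 1 := rfl

/-- The scaled cut-off `ψ_R(x) = ψ₁(R⁻¹ x)`. -/
def ψR (R : ℝ) (x : ℝ³) : ℝ := ψ₁ (R⁻¹ • x)

/-- `ψ_R` is smooth. -/
theorem ψR_contDiff (R : ℝ) {n : ℕ∞} : ContDiff ℝ n (ψR R) :=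
  (ψ₁.contDiff (n := n)).comp (contDiff_const_smul R⁻¹)

/-- `0 ≤ ψ_R`. -/
theorem ψR_nonneg (R : ℝ) (x : ℝ³) : 0 ≤ ψR R x := ψ₁.nonneg

/-- `ψ_R ≤ 1`. -/
theorem ψR_le_one (R : ℝ) (x : ℝ³) : ψR R x ≤ 1 := ψ₁.le_one

/-- `ψ_R = 1` on the closed ball of radius `R` (`R > 0`). -/
theorem ψR_eq_one {R : ℝ} (hR : 0 < R) {x : ℝ³} (hx : ‖x‖ ≤ R) : ψR R x = 1 := by
  apply ψ₁.one_of_mem_closedBall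
  rw [mem_closedBall, dist_zero_right, norm_smul, norm_inv, Real.norm_eq_abs, abs_of_pos hR, ψ₁_rIn]
  rw [inv_mul_le_iff₀ hR]; simpa using hx

/-- `ψ_R = 0` off the ball of radius `2R` (`R > 0`). -/
theorem ψR_eq_zero {R : ℝ} (hR : 0 < R) {x : ℝ³} (hx : 2 * R ≤ ‖x‖) : ψR R x = 0 := by
  apply ψ₁.zero_of_le_dist
  rw [dist_zero_right, norm_smul, norm_inv, Real.norm_eq_abs, abs_of_pos hR, ψ₁_rOut]
  rw [le_inv_mul_iff₀ hR]; linarith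

/-- `ψ_R = 0` off `closedBall 0 (2R)`. -/
theorem ψR_eq_zero_of_not_mem {R : ℝ} (hR : 0 < R) {x : ℝ³} (hx : x ∉ closedBall (0 : ℝ³) (2 * R)) :
    ψR R x = 0 := by
  rw [mem_closedBall, dist_zero_right, not_le] at hx
  exact ψR_eq_zero hR hx.le

/-- `ψ_R` is eventually `1` near every point of the open ball of radius `R`. -/
theorem ψR_eventuallyEq_one {R : ℝ} (hR : 0 < R) {x : ℝ³} (hx : ‖x‖ < R) :
    ψR R =ᶠ[𝓝 x] fun _ => (1 : ℝ) := by
  have hopen : IsOpen (ball (0 : ℝ³) R) := isOpen_ball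
  have hxmem : x ∈ ball (0 : ℝ³) R := by rwa [mem_ball, dist_zero_right]
  filter_upwards [hopen.mem_nhds hxmem] with y hy
  rw [mem_ball, dist_zero_right] at hy
  exact ψR_eq_one hR hy.le

/-- `Dψ_R = 0` on the open ball of radius `R`. -/
theorem fderiv_ψR_eq_zero {R : ℝ} (hR : 0 < R) {x : ℝ³} (hx : ‖x‖ < R) : fderiv ℝ (ψR R) x = 0 := by
  rw [(ψR_eventuallyEq_one hR hx).fderiv_eq]; simp

/-- `Δψ_R = 0` on the open ball of radius `R`. -/
theorem laplacian_ψR_eq_zero {R : ℝ} (hR : 0 < R) {x : ℝ³} (hx : ‖x‖ < R) : (Δ (ψR R)) x = 0 := by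
  have h := (InnerProductSpace.laplacian_congr_nhds (ψR_eventuallyEq_one hR hx)).eq_of_nhds
  rw [h]
  rw [InnerProductSpace.laplacian_eq_iteratedFDeriv_orthonormalBasis _ (stdOrthonormalBasis ℝ ℝ³)]
  simp [iteratedFDeriv_const_of_ne]

/-- A global bound for `‖Dψ₁‖`. -/
theorem exists_bound_fderiv_ψ₁ : ∃ M₁ : ℝ, 0 ≤ M₁ ∧ ∀ x : ℝ³, ‖fderiv ℝ ψ₁ x‖ ≤ M₁ := by
  have hc : Continuous fun x : ℝ³ => fderiv ℝ ψ₁ x := (ψ₁.contDiff (n := 1)).continuous_fderiv (by norm_num)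
  obtain ⟨C, hC⟩ := hc.bounded_above_of_compact_support (ψ₁.hasCompactSupport.fderiv (𝕜 := ℝ))
  exact ⟨max C 0, le_max_right _ _, fun x => (hC x).trans (le_max_left _ _)⟩

/-- A global bound for `|Δψ₁|`. -/
theorem exists_bound_laplacian_ψ₁ : ∃ M₂ : ℝ, 0 ≤ M₂ ∧ ∀ x : ℝ³, ‖(Δ (ψ₁ : ℝ³ → ℝ)) x‖ ≤ M₂ := by
  have hc : Continuous (Δ (ψ₁ : ℝ³ → ℝ)) := continuous_laplacian (ψ₁.contDiff (n := 2))
  have hs : HasCompactSupport (Δ (ψ₁ : ℝ³ → ℝ)) := by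
    refine HasCompactSupport.intro (isCompact_closedBall (0 : ℝ³) 2) fun x hx => ?_
    apply laplacian_eq_zero_of_notMem_tsupport
    rwa [ψ₁.tsupport_eq, ψ₁_rOut]
  obtain ⟨C, hC⟩ := hc.bounded_above_of_compact_support hs
  exact ⟨max C 0, le_max_right _ _, fun x => (hC x).trans (le_max_left _ _)⟩

/-- Chain rule for the scaled cut-off: `Dψ_R(x) = R⁻¹ • Dψ₁(R⁻¹x)`. -/
theorem fderiv_ψR (R : ℝ) (x : ℝ³) : fderiv ℝ (ψR R) x = R⁻¹ • fderiv ℝ ψ₁ (R⁻¹ • x) := by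
  show fderiv ℝ (fun y => ψ₁ (R⁻¹ • y)) x = _
  exact _root_.fderiv_comp_smul R⁻¹

/-- `D(k • f(c ·))(x) = (k c) • Df(c x)` for all `k c : ℝ`, with no differentiability hypothesis
(both sides are the junk value `0` together). [folklore] -/
theorem fderiv_const_smul_comp_smul_apply' {F : Type*} [NormedAddCommGroup F] [NormedSpace ℝ F]
    (f : ℝ³ → F) (k c : ℝ) (x : ℝ³) :
    fderiv ℝ (fun y => k • f (c • y)) x = (k * c) • fderiv ℝ f (c • x) := by
  have h : (fun y => k • f (c • y)) = k • fun y => f (c • y) := rfl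
  rw [h, fderiv_const_smul_field, Pi.smul_apply, _root_.fderiv_comp_smul, smul_smul]

/-- `D²(f(c ·)) = z ↦ c² • D²f(c z)`. [folklore] -/
theorem fderiv_fderiv_comp_smul' {F : Type*} [NormedAddCommGroup F] [NormedSpace ℝ F]
    (f : ℝ³ → F) (c : ℝ) :
    fderiv ℝ (fderiv ℝ fun y => f (c • y)) = fun z => c ^ 2 • fderiv ℝ (fderiv ℝ f) (c • z) := by
  have h1 : (fderiv ℝ fun y => f (c • y)) = fun z => c • fderiv ℝ f (c • z) := by
    funext z
    simpa using fderiv_const_smul_comp_smul_apply' f 1 c z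
  rw [h1]
  funext z
  rw [fderiv_const_smul_comp_smul_apply' (fderiv ℝ f) c c z, sq]

/-- **Laplacian of a dilation**: `Δ(f(c ·))(x) = c² • (Δf)(c x)`. [folklore] -/
theorem laplacian_comp_smul_eq' {F : Type*} [NormedAddCommGroup F] [NormedSpace ℝ F]
    (f : ℝ³ → F) (c : ℝ) (x : ℝ³) :
    (Δ fun y => f (c • y)) x = c ^ 2 • (Δ f) (c • x) := by
  rw [InnerProductSpace.laplacian_eq_iteratedFDeriv_orthonormalBasis _ (stdOrthonormalBasis ℝ ℝ³),
    InnerProductSpace.laplacian_eq_iteratedFDeriv_orthonormalBasis _ (stdOrthonormalBasis ℝ ℝ³)]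
  simp only [iteratedFDeriv_two_apply, Finset.smul_sum, fderiv_fderiv_comp_smul' f c]
  simp

/-- `Δψ_R(x) = R⁻² Δψ₁(R⁻¹ x)`. -/
theorem laplacian_ψR (R : ℝ) (x : ℝ³) : (Δ (ψR R)) x = (R⁻¹) ^ 2 * (Δ (ψ₁ : ℝ³ → ℝ)) (R⁻¹ • x) := by
  have h := laplacian_comp_smul_eq' (ψ₁ : ℝ³ → ℝ) R⁻¹ x
  rw [smul_eq_mul] at h
  exact h

/-- **`R`-uniform bound** (`R ≥ 1`): `‖Dψ_R(x)‖ ≤ M₁`. -/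
theorem norm_fderiv_ψR_le {M₁ : ℝ} (hb : ∀ x : ℝ³, ‖fderiv ℝ ψ₁ x‖ ≤ M₁) {R : ℝ}
    (hR : 1 ≤ R) (x : ℝ³) : ‖fderiv ℝ (ψR R) x‖ ≤ M₁ := by
  rw [fderiv_ψR, norm_smul, norm_inv, Real.norm_eq_abs, abs_of_pos (by linarith)]
  calc R⁻¹ * ‖fderiv ℝ (⇑ψ₁) (R⁻¹ • x)‖ ≤ 1 * M₁ := by
        refine mul_le_mul (inv_le_one_of_one_le₀ hR) (hb _) (norm_nonneg _) zero_le_one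
    _ = M₁ := one_mul _

/-- `|Δψ_R| ≤ M₂` for `R ≥ 1`. -/
theorem abs_laplacian_ψR_le {M₂ : ℝ} (hb : ∀ x : ℝ³, ‖(Δ (ψ₁ : ℝ³ → ℝ)) x‖ ≤ M₂)
    {R : ℝ} (hR : 1 ≤ R) (x : ℝ³) : |(Δ (ψR R)) x| ≤ M₂ := by
  rw [laplacian_ψR, abs_mul]
  have h1 : |(R⁻¹) ^ 2| ≤ 1 := by
    rw [abs_of_nonneg (sq_nonneg _)]
    have : R⁻¹ ≤ 1 := inv_le_one_of_one_le₀ hR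
    have h0 : 0 ≤ R⁻¹ := inv_nonneg.2 (by linarith)
    nlinarith
  have h2 := hb (R⁻¹ • x)
  rw [Real.norm_eq_abs] at h2
  calc |(R⁻¹) ^ 2| * |(Δ (ψ₁ : ℝ³ → ℝ)) (R⁻¹ • x)| ≤ 1 * M₂ :=
        mul_le_mul h1 h2 (abs_nonneg _) zero_le_one
    _ = M₂ := one_mul _

/-- Decaying bound: `‖Dψ_R(x)‖ ≤ M₁/R` (`R > 0`). -/
theorem norm_fderiv_ψR_le_div {M₁ : ℝ} (hb : ∀ x : ℝ³, ‖fderiv ℝ ψ₁ x‖ ≤ M₁) {R : ℝ} (hR : 0 < R)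
    (x : ℝ³) : ‖fderiv ℝ (ψR R) x‖ ≤ M₁ / R := by
  rw [fderiv_ψR, norm_smul, norm_inv, Real.norm_eq_abs, abs_of_pos hR, div_eq_inv_mul]
  exact mul_le_mul_of_nonneg_left (hb _) (inv_nonneg.2 hR.le)

/-- `|Δψ_R| ≤ M₂/R²` for `R > 0`. -/
theorem abs_laplacian_ψR_le_div {M₂ : ℝ} (hb : ∀ x : ℝ³, ‖(Δ (ψ₁ : ℝ³ → ℝ)) x‖ ≤ M₂) {R : ℝ}
    (hR : 0 < R) (x : ℝ³) : |(Δ (ψR R)) x| ≤ M₂ / R ^ 2 := by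
  rw [laplacian_ψR, abs_mul, abs_of_nonneg (sq_nonneg _), inv_pow, div_eq_inv_mul]
  have h2 := hb (R⁻¹ • x)
  rw [Real.norm_eq_abs] at h2
  exact mul_le_mul_of_nonneg_left h2 (inv_nonneg.2 (pow_nonneg hR.le 2))

end Bump

/-! ### §C The compressible witness drift `b(t, x) = arctan(x₀) e₀` -/

section Drift

/-- The first basis vector `e₀`. -/
def e0 : ℝ³ := EuclideanSpace.single 0 1

/-- `‖e₀‖ = 1`. [folklore] -/
@[simp] theorem norm_e0 : ‖e0‖ = 1 := by simp [e0]

/-- The first coordinate as a continuous linear functional. -/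
def π0 : ℝ³ →L[ℝ] ℝ := EuclideanSpace.proj (0 : Fin 3)

/-- `π₀ x = x₀`. -/
@[simp] theorem π0_apply (x : ℝ³) : π0 x = x 0 := rfl

/-- **The witness drift** (time-independent, smooth, bounded by `π/2`, COMPRESSIBLE):
`b(t, x) = arctan(x₀) • e₀`, `div b = 1/(1 + x₀²) > 0`. -/
def bComp : ℝ → ℝ³ → ℝ³ := fun _ x => Real.arctan (π0 x) • e0

/-- Unfolding the witness drift. -/
theorem bComp_apply (t : ℝ) (x : ℝ³) : bComp t x = Real.arctan (x 0) • e0 := rfl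

/-- `‖b‖ ≤ π/2 < 2`. -/
theorem norm_bComp_le (t : ℝ) (x : ℝ³) : ‖bComp t x‖ ≤ 2 := by
  rw [bComp_apply, norm_smul, norm_e0, mul_one, Real.norm_eq_abs]
  have h1 := Real.arctan_lt_pi_div_two (x 0)
  have h2 := Real.neg_pi_div_two_lt_arctan (x 0)
  have hπ : Real.pi / 2 < 2 := by linarith [Real.pi_lt_four]
  rw [abs_le]; constructor <;> linarith

/-- The drift is jointly smooth on every time set. -/
theorem isSmoothSpaceTimeOn_bComp (S : Set ℝ) : IsSmoothSpaceTimeOn S bComp := by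
  have h : ContDiff ℝ (⊤ : ℕ∞) (uncurry bComp) := by
    have h1 : ContDiff ℝ (⊤ : ℕ∞) fun p : ℝ × ℝ³ => Real.arctan (π0 p.2) :=
      Real.contDiff_arctan.comp (π0.contDiff.comp contDiff_snd)
    exact h1.smul contDiff_const
  exact h.contDiffOn

/-- The slices are `C¹` (indeed smooth). -/
theorem contDiff_bComp (t : ℝ) {n : WithTop ℕ∞} : ContDiff ℝ n (bComp t) :=
  (Real.contDiff_arctan.comp π0.contDiff).smul contDiff_const

/-- The derivative of the drift: `Db(x) v = (1/(1 + x₀²)) v₀ • e₀`. -/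
theorem hasFDerivAt_bComp (t : ℝ) (x : ℝ³) :
    HasFDerivAt (bComp t) (((1 / (1 + (x 0) ^ 2)) • π0).smulRight e0) x := by
  have h1 : HasFDerivAt (fun y : ℝ³ => Real.arctan (π0 y)) ((1 / (1 + (π0 x) ^ 2)) • π0) x :=
    (Real.hasDerivAt_arctan (π0 x)).comp_hasFDerivAt x π0.hasFDerivAt
  exact h1.smul_const e0

/-- **The divergence of the witness drift**: `div b(t, ·)(x) = 1/(1 + x₀²)`. -/
theorem divergence_bComp (t : ℝ) (x : ℝ³) :
    VectorCalculus.divergence (bComp t) x = 1 / (1 + (x 0) ^ 2) := by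
  rw [divergence_eq_sum_inner_fderiv (EuclideanSpace.basisFun (Fin 3) ℝ), (hasFDerivAt_bComp t x).fderiv]
  simp [Fin.sum_univ_three, e0, EuclideanSpace.inner_single_left, ContinuousLinearMap.smulRight_apply]

/-- `div b > 0`. -/
theorem divergence_bComp_pos (t : ℝ) (x : ℝ³) : 0 < VectorCalculus.divergence (bComp t) x := by
  rw [divergence_bComp]; positivity

/-- `div b ≥ 0`. -/
theorem divergence_bComp_nonneg (t : ℝ) (x : ℝ³) : 0 ≤ VectorCalculus.divergence (bComp t) x :=
  (divergence_bComp_pos t x).le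

/-- `div b ≤ 1`. -/
theorem divergence_bComp_le_one (t : ℝ) (x : ℝ³) : VectorCalculus.divergence (bComp t) x ≤ 1 := by
  rw [divergence_bComp, div_le_one (by positivity)]
  nlinarith [sq_nonneg (x 0)]

/-- On the closed unit ball the divergence is at least `1/2`. -/
theorem half_le_divergence_bComp (t : ℝ) {x : ℝ³} (hx : ‖x‖ ≤ 1) :
    1 / 2 ≤ VectorCalculus.divergence (bComp t) x := by
  rw [divergence_bComp]
  have h0 : |x 0| ≤ ‖x‖ := by
    have := PiLp.norm_apply_le x 0
    simpa using this
  have h1 : (x 0) ^ 2 ≤ 1 := by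
    have : |x 0| ≤ 1 := h0.trans hx
    have h2 : (x 0) ^ 2 = |x 0| ^ 2 := (sq_abs _).symm
    rw [h2]; nlinarith [abs_nonneg (x 0)]
  rw [div_le_div_iff₀ (by norm_num) (by positivity)]
  linarith

end Drift

/-! ### §D Gaussian envelope bookkeeping on a compact block of times -/

section Gauss

/-- Gaussians are integrable on `ℝ³` (their integral is `(π/a)^{3/2} ≠ 0`). [folklore] -/
theorem integrable_gaussian {a : ℝ} (ha : 0 < a) :
    Integrable (fun x : ℝ³ => Real.exp (-a * ‖x‖ ^ 2)) := by
  by_contra h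
  have h1 := GaussianFourier.integral_rexp_neg_mul_sq_norm (V := ℝ³) ha
  rw [integral_undef h] at h1
  have : 0 < (Real.pi / a) ^ ((Module.finrank ℝ ℝ³ : ℝ) / 2) := by positivity
  exact this.ne h1

/-- `h ↦ h^{-3/2}` is antitone on `(0, ∞)`. [folklore] -/
theorem rpow_negThreeHalves_antitone {a b : ℝ} (ha : 0 < a) (hab : a ≤ b) :
    b ^ (-(3 : ℝ) / 2) ≤ a ^ (-(3 : ℝ) / 2) :=
  Real.rpow_le_rpow_of_nonpos ha hab (by norm_num)

/-- **Uniform bulk lower bound**: on the closed unit ball and for block times `h₂ ≤ h ≤ h₁`,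
the lower Gaussian `c₁ h^{-3/2} e^{-‖x‖²/(c₂h)}` is at least the constant
`c₁ h₁^{-3/2} e^{-1/(c₂h₂)}`. -/
theorem gauss_lower_unitBall {c₁ c₂ h h₁ h₂ : ℝ} (hc₁ : 0 ≤ c₁) (hc₂ : 0 < c₂) (hh₂ : 0 < h₂)
    (h2h : h₂ ≤ h) (hh1 : h ≤ h₁) {x : ℝ³} (hx : ‖x‖ ≤ 1) :
    c₁ * h₁ ^ (-(3 : ℝ) / 2) * Real.exp (-(1 / (c₂ * h₂))) ≤
      c₁ * h ^ (-(3 : ℝ) / 2) * Real.exp (-(‖x‖ ^ 2) / (c₂ * h)) := by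
  have hh : 0 < h := hh₂.trans_le h2h
  refine mul_le_mul (mul_le_mul_of_nonneg_left (rpow_negThreeHalves_antitone hh hh1) hc₁)
    (Real.exp_le_exp.2 ?_) (Real.exp_pos _).le (by positivity)
  rw [neg_div, neg_le_neg_iff]
  have h1 : ‖x‖ ^ 2 ≤ 1 := by nlinarith [norm_nonneg x]
  calc ‖x‖ ^ 2 / (c₂ * h) ≤ 1 / (c₂ * h) := div_le_div_of_nonneg_right h1 (by positivity)
    _ ≤ 1 / (c₂ * h₂) := one_div_le_one_div_of_le (by positivity) (by nlinarith)

/-- **Uniform tail bound**: off the ball of radius `R` and for block times `h₂ ≤ h ≤ h₁`, the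
upper Gaussian `C₁ h^{-3/2} e^{-‖x‖²/(C₂h)}` is at most
`e^{-R²/(2C₂h₁)} · C₁ h₂^{-3/2} e^{-‖x‖²/(2C₂h₁)}` — a fixed integrable profile times a factor
that tends to `0` as `R → ∞`. -/
theorem gauss_upper_tail {C₁ C₂ h h₁ h₂ R : ℝ} (hC₁ : 0 ≤ C₁) (hC₂ : 0 < C₂) (hh₂ : 0 < h₂)
    (h2h : h₂ ≤ h) (hh1 : h ≤ h₁) {x : ℝ³} (hx : R ≤ ‖x‖) (hR : 0 ≤ R) :
    C₁ * h ^ (-(3 : ℝ) / 2) * Real.exp (-(‖x‖ ^ 2) / (C₂ * h)) ≤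
      Real.exp (-(R ^ 2) / (2 * C₂ * h₁)) *
        (C₁ * h₂ ^ (-(3 : ℝ) / 2) * Real.exp (-(‖x‖ ^ 2) / (2 * C₂ * h₁))) := by
  have hh : 0 < h := hh₂.trans_le h2h
  have hh₁ : 0 < h₁ := hh.trans_le hh1
  have hpow : h ^ (-(3 : ℝ) / 2) ≤ h₂ ^ (-(3 : ℝ) / 2) := rpow_negThreeHalves_antitone hh₂ h2h
  have hexp : Real.exp (-(‖x‖ ^ 2) / (C₂ * h)) ≤
      Real.exp (-(R ^ 2) / (2 * C₂ * h₁)) * Real.exp (-(‖x‖ ^ 2) / (2 * C₂ * h₁)) := by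
    rw [← Real.exp_add]
    refine Real.exp_le_exp.2 ?_
    have h1 : ‖x‖ ^ 2 / (C₂ * h₁) ≤ ‖x‖ ^ 2 / (C₂ * h) :=
      div_le_div_of_nonneg_left (sq_nonneg _) (by positivity) (by nlinarith)
    have h2 : R ^ 2 ≤ ‖x‖ ^ 2 := pow_le_pow_left₀ hR hx 2
    have h3 : R ^ 2 / (2 * C₂ * h₁) ≤ ‖x‖ ^ 2 / (2 * C₂ * h₁) :=
      div_le_div_of_nonneg_right h2 (by positivity)
    have h4 : ‖x‖ ^ 2 / (2 * C₂ * h₁) + ‖x‖ ^ 2 / (2 * C₂ * h₁) = ‖x‖ ^ 2 / (C₂ * h₁) := by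
      field_simp; ring
    rw [neg_div, neg_div, neg_div]
    linarith
  calc C₁ * h ^ (-(3 : ℝ) / 2) * Real.exp (-(‖x‖ ^ 2) / (C₂ * h))
      ≤ C₁ * h₂ ^ (-(3 : ℝ) / 2) *
          (Real.exp (-(R ^ 2) / (2 * C₂ * h₁)) * Real.exp (-(‖x‖ ^ 2) / (2 * C₂ * h₁))) :=
        mul_le_mul (mul_le_mul_of_nonneg_left hpow hC₁) hexp (Real.exp_pos _).le (by positivity)
    _ = _ := by ring

/-- The tail factor tends to zero: `e^{-R²/(2C₂h₁)} → 0` as `R → ∞`. [folklore] -/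
theorem tendsto_tailFactor {C₂ h₁ : ℝ} (hC₂ : 0 < C₂) (hh₁ : 0 < h₁) :
    Tendsto (fun R : ℝ => Real.exp (-(R ^ 2) / (2 * C₂ * h₁))) atTop (𝓝 0) := by
  have h1 : Tendsto (fun R : ℝ => R ^ 2 / (2 * C₂ * h₁)) atTop atTop :=
    (tendsto_pow_atTop two_ne_zero).atTop_div_const (by positivity)
  have h2 := Real.tendsto_exp_neg_atTop_nhds_zero.comp h1
  refine h2.congr fun R => ?_
  simp [neg_div]

/-- The integrable tail profile `γ(x) = C₁ h₂^{-3/2} e^{-‖x‖²/(2C₂h₁)}`. -/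
theorem integrable_tailProfile {C₁ C₂ h₁ h₂ : ℝ} (hC₂ : 0 < C₂) (hh₁ : 0 < h₁) :
    Integrable (fun x : ℝ³ => C₁ * h₂ ^ (-(3 : ℝ) / 2) * Real.exp (-(‖x‖ ^ 2) / (2 * C₂ * h₁))) := by
  have h := (integrable_gaussian (a := 1 / (2 * C₂ * h₁)) (by positivity)).const_mul
    (C₁ * h₂ ^ (-(3 : ℝ) / 2))
  refine h.congr (Eventually.of_forall fun x => ?_)
  simp only
  congr 2
  ring

end Gauss

end Summit.NavierStokesRegularity.NavierStokesRegularity.Theorems.AdaptedKernelExistsNegative.DivFree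

end
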